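import Summits.BirchSwinnertonDyer.BirchSwinnertonDyer.Theorems.BiquadraticEisensteinDescentHeegnerTwistCouplingInSupplySylvesterCornerTableII
import Summits.BirchSwinnertonDyer.BirchSwinnertonDyer.Theorems.BiquadraticEisensteinDescentHeegnerTwistCouplingInSupplyDeuringHeckeLeaf
import HarnessLib

set_option linter.dupNamespace false -- `Summit.BirchSwinnertonDyer.BirchSwinnertonDyer.Theorems.…` (summit = sub, D-0017)
set_option autoImplicit false

/-!
# Crux `HeegnerTwistCouplingInSupply` (stmt-BirchSwinnertonDyer-21381) — the SYLVESTER `j = 0` corner, IV: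
# the Deuring–Hecke binder DISCHARGED — everything modulo the `3`-descent hypothesis and Burungale–Tian ONLY

Route `BiquadraticEisensteinDescent` (cell `pub/bsd-wall`; width seat `bsd-wall-cm-bed-w4` g26; theorems only, `--supports` 21381,
helper). The files `…SylvesterCorner`, `…SylvesterCornerTable`, `…SylvesterCornerTableII` carry the continuation leaf
`hH : hasEntireLFunction_of_j_mem_maximalCMJInvariants` as a hypothesis. It is a THEOREM of the tree
(`…DeuringHeckeLeaf.hasEntireLFunction_of_j_mem_maximalCMJInvariants_holds`: all nine CM rows by Hecke theta series in the kernel, no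
modularity; for `j = 0` the sextic-twist dictionary `DeuringHecke.hasEntireLFunction_of_j_eq_zero`). This file feeds it in:

* `L_one_ne_zero_of_desc_BT` — for ANY elliptic `E/ℚ` with `j(E) = 0`: `rank E(ℚ) = 0 ∧ Ш(E/ℚ)[3] = 0 ⟹ r_an(E) = 0 ∧ L(E, 1) ≠ 0`,
  modulo Burungale–Tian ONLY;
* ★ `exists_cruxConclusion_of_certificate_BT` — the certificate door of `…SylvesterCorner` without `hH`;
* ★★ `cruxOnSylvesterCorner_of_desc_BT_lt5` — EVERY prime `p ≡ 8 (mod 9)` below `10⁵`: the conclusion of crux 21381 at `(W_p, p)`,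
  `W_p : y² + p·y = x³`, with `K′ = ℚ(√D)`, `h(K′) < p`, modulo the `3`-descent hypothesis `hDesc` (card `splitting-bias` L1, Lucas form)
  and Burungale–Tian's corank-zero converse ONLY.

HONEST FRAMING: corner layer on one CM family; `hDesc` (the `3`-isogeny descent for `y² = x³ + 16p²D³`) is NOT formalised; nothing here
proves the crux or BSD. No definition, no named fact, no `sorry`; axioms standard.
[cite: SilvermanATAEC1994, Ch. II Cor. 10.5.1] [cite: Hecke1920, §9] [cite: BurungaleTian2026, Thm. 1.1] [cite: CohenPazuki2009, §2]
-/

noncomputable section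

open scoped Classical NumberField

namespace Summit.BirchSwinnertonDyer.BirchSwinnertonDyer.Theorems.SylvesterCorner

open _root_.WeierstrassCurve Literature.NumberTheory.EllipticCurves
open Summit.BirchSwinnertonDyer.BirchSwinnertonDyer.Theorems.BiquadraticEisensteinDescentHeegnerTwistCouplingInSupplyDeuringHeckeLeaf
  (hasEntireLFunction_of_j_mem_maximalCMJInvariants_holds)

/-- **The door at `3` for `j = 0`, Burungale–Tian ONLY**: `rank E(ℚ) = 0 ∧ Ш(E/ℚ)[3] = 0 ⟹ r_an(E) = 0 ∧ L(E, 1) ≠ 0` for every elliptic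
`E/ℚ` with `j(E) = 0` (continuation by the sextic-twist theta dictionary, `DeuringHecke.hasEntireLFunction_of_j_eq_zero`).
[cite: BurungaleTian2026, Thm. 1.1] [cite: SilvermanATAEC1994, Ch. II Cor. 10.5.1] [cite: Hecke1920, §9] -/
theorem L_one_ne_zero_of_desc_BT (hBT : burungaleTian_analyticRank_eq_zero_of_selmerCorank_eq_zero_of_hasCM)
    (E : WeierstrassCurve ℚ) [E.IsElliptic] (hj : E.j = 0)
    (hrank : E.mordellWeilRank = 0) (hsha : ∀ c ∈ E.sha, 3 • c = 0 → c = 0) :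
    E.analyticRank = 0 ∧ E.entireLFunction 1 ≠ 0 := by
  haveI : Fact (Nat.Prime 3) := ⟨Nat.prime_three⟩
  have hCM : E.HasCM := WeierstrassCurve.hasCM_of_j_eq_zero _ hj
  have h0 := hBT _ hCM 3 (selmerCorank_three_eq_zero E hrank hsha)
  exact ⟨h0, (analyticRank_eq_zero_iff_holds (W := E) (DeuringHecke.hasEntireLFunction_of_j_eq_zero E hj)).1 h0⟩

/-- ★ **The certificate door, `∃ K′` form, without the continuation binder**: as `exists_cruxConclusion_of_certificate`, modulo `hDesc`
and Burungale–Tian ONLY. [cite: CohenPazuki2009, §2] [cite: BurungaleTian2026, Thm. 1.1] [cite: SilvermanATAEC1994, Ch. II Cor. 10.5.1] -/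
theorem exists_cruxConclusion_of_certificate_BT
    (hDesc : ∀ (p : ℕ) (K : Type) [Field K] [NumberField K] (M a b : ℤ), p.Prime → p % 9 = 8 →
      IsImaginaryQuadratic K → 4 < (NumberField.discr K).natAbs →
      jacobiSym (NumberField.discr K) 3 = 1 → jacobiSym (NumberField.discr K) p = 1 →
      ¬ 3 ∣ NumberField.classNumber K → M = -3 * NumberField.discr K → a ^ 2 - M * b ^ 2 = 4 →
      ¬ (p : ℤ) ∣ ((⟨a, b⟩ : ℤ√M) ^ ((p + 1) / 3)).im →
      ((⟨0, 0, (p : ℚ), 0, 0⟩ : WeierstrassCurve ℚ).quadraticTwist (NumberField.discr K : ℚ)).mordellWeilRank = 0 ∧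
      ∀ c ∈ ((⟨0, 0, (p : ℚ), 0, 0⟩ : WeierstrassCurve ℚ).quadraticTwist (NumberField.discr K : ℚ)).sha,
        3 • c = 0 → c = 0)
    (hBT : burungaleTian_analyticRank_eq_zero_of_selmerCorank_eq_zero_of_hasCM)
    {p : ℕ} (hp : p.Prime) (hp9 : p % 9 = 8) [(⟨0, 0, (p : ℚ), 0, 0⟩ : WeierstrassCurve ℚ).IsElliptic]
    {D : ℤ} {h : ℕ} (hKex : ∃ (K : Type) (_ : Field K) (_ : NumberField K),
      IsImaginaryQuadratic K ∧ NumberField.discr K = D ∧ NumberField.classNumber K = h)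
    (hD4 : 4 < D.natAbs) (hJ3 : jacobiSym D 3 = 1) (hJp : jacobiSym D p = 1) (hh : h < p) (hh3 : ¬ 3 ∣ h)
    {M a b : ℤ} (hM : M = -3 * D) (hab : a ^ 2 - M * b ^ 2 = 4)
    (hL : ¬ (p : ℤ) ∣ ((⟨a, b⟩ : ℤ√M) ^ ((p + 1) / 3)).im) :
    ∃ (K : Type) (_ : Field K) (_ : NumberField K),
      IsImaginaryQuadratic K ∧ 4 < (NumberField.discr K).natAbs ∧
      SatisfiesHeegnerHypothesis ((⟨0, 0, (p : ℚ), 0, 0⟩ : WeierstrassCurve ℚ).conductorNorm ℤ) K ∧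
      ((⟨0, 0, (p : ℚ), 0, 0⟩ : WeierstrassCurve ℚ).quadraticTwist (NumberField.discr K : ℚ)).entireLFunction 1 ≠ 0 ∧
      NumberField.classNumber K < p ∧ ¬ p ∣ NumberField.classNumber K :=
  exists_cruxConclusion_of_certificate hDesc hBT hasEntireLFunction_of_j_mem_maximalCMJInvariants_holds hp hp9 hKex hD4 hJ3 hJp
    hh hh3 hM hab hL

/-- ★★ **The Sylvester corner below `10⁵`, modulo the `3`-descent hypothesis and Burungale–Tian ONLY.** For every prime `p ≡ 8 (mod 9)`
with `p < 10⁵`: a Heegner field `K′ = ℚ(√D)` of `N(W_p)` with `4 < |d_{K′}|`, `L(W_p^{(d_{K′})}, 1) ≠ 0`, `h(K′) < p`, `p ∤ h(K′)` — the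
conclusion of `HeegnerTwistCouplingInSupply` at `(W_p, p)` (the tables of II/III with the Deuring–Hecke binder fed by the tree's theorem).
[cite: CohenPazuki2009, §2] [cite: BurungaleTian2026, Thm. 1.1] [cite: SilvermanATAEC1994, Ch. II Cor. 10.5.1] [cite: Hecke1920, §9] -/
theorem cruxOnSylvesterCorner_of_desc_BT_lt5
    (hDesc : ∀ (p : ℕ) (K : Type) [Field K] [NumberField K] (M a b : ℤ), p.Prime → p % 9 = 8 →
      IsImaginaryQuadratic K → 4 < (NumberField.discr K).natAbs →
      jacobiSym (NumberField.discr K) 3 = 1 → jacobiSym (NumberField.discr K) p = 1 →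
      ¬ 3 ∣ NumberField.classNumber K → M = -3 * NumberField.discr K → a ^ 2 - M * b ^ 2 = 4 →
      ¬ (p : ℤ) ∣ ((⟨a, b⟩ : ℤ√M) ^ ((p + 1) / 3)).im →
      ((⟨0, 0, (p : ℚ), 0, 0⟩ : WeierstrassCurve ℚ).quadraticTwist (NumberField.discr K : ℚ)).mordellWeilRank = 0 ∧
      ∀ c ∈ ((⟨0, 0, (p : ℚ), 0, 0⟩ : WeierstrassCurve ℚ).quadraticTwist (NumberField.discr K : ℚ)).sha,
        3 • c = 0 → c = 0)
    (hBT : burungaleTian_analyticRank_eq_zero_of_selmerCorank_eq_zero_of_hasCM) :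
    ∀ (p : ℕ) [Fact p.Prime] [(⟨0, 0, (p : ℚ), 0, 0⟩ : WeierstrassCurve ℚ).IsElliptic]
      [(⟨0, 0, (p : ℚ), 0, 0⟩ : WeierstrassCurve ℚ).IsGloballyMinimal]
      [NeZero ((⟨0, 0, (p : ℚ), 0, 0⟩ : WeierstrassCurve ℚ).conductorNorm ℤ)],
      p % 9 = 8 → p < 100000 →
      ∃ (K : Type) (_ : Field K) (_ : NumberField K),
        IsImaginaryQuadratic K ∧ 4 < (NumberField.discr K).natAbs ∧
        SatisfiesHeegnerHypothesis ((⟨0, 0, (p : ℚ), 0, 0⟩ : WeierstrassCurve ℚ).conductorNorm ℤ) K ∧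
        ((⟨0, 0, (p : ℚ), 0, 0⟩ : WeierstrassCurve ℚ).quadraticTwist (NumberField.discr K : ℚ)).entireLFunction 1 ≠ 0 ∧
        NumberField.classNumber K < p ∧ ¬ p ∣ NumberField.classNumber K :=
  cruxOnSylvesterCorner_of_desc_lt5 hDesc hBT hasEntireLFunction_of_j_mem_maximalCMJInvariants_holds

end Summit.BirchSwinnertonDyer.BirchSwinnertonDyer.Theorems.SylvesterCorner
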